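import Summits.KontsevichZagierPeriods.KontsevichZagierPeriods.Theorems.RootDecompRelativeModAbsoluteAngleFoldP8

/-! # `RootDecompRelativeModAbsoluteAngleFoldP9` — part 9/9 of the mechanical ≤400-line split of `af_src.lean` (sha256 2a2742458ba4dd14…)
Source: decomp-kz lens-3 g14 AngleFold.lean @5fd37862 (lint-fixed copy @30e24be4 by writer g8 per critic g6-12): ANGLE ADDITION IN FAMILIES — angleCellwiseFoldAt_one : AngleCellwiseFoldAt 1 PROVED (critic CLEARED g6-12 l.1335); --supports stmt-KontsevichZagierPeriods-30572.
Split by census-1 g10 `gen/splitlean.py`: scopes re-opened with their `open`/`variable`/`set_option` context; mathematics and declaration order unchanged. -/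

noncomputable section
open Set MeasureTheory
open Literature.NumberTheory.Transcendental Literature.ModelTheory.ExponentialFields
namespace Summit.KontsevichZagierPeriods.RootDecompRelativeModAbsolute.Rung30571.RegularisedLogLayer.CylLog.Leaf.G13
namespace AngleFold

/-- **MAIN THEOREM: `AngleCellwiseFoldAt 1`** — angle addition in families at base dimension `1`.  Stated verbatim as the
body of `CircleSplit.AngleCellwiseFoldAt` at `n = 1` (that file is not importable here; the bridge
`angleCellwiseFoldAt_one : AngleCellwiseFoldAt 1 := AngleFold.angleCellwiseFold_one` is by `rfl`-unfolding). -/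
theorem angleCellwiseFold_one :
    ∀ (l : ℕ) (σ : Set (Fin 1 → ℝ)) (p u : Fin l → (Fin 1 → ℝ) → ℝ) (A : Fin l → KZ.IntegralRep (1 + 1))
      (N : ℕ) (C : Fin N → Set (Fin 1 → ℝ)),
      IsSemialgebraic ℚ σ → (∀ j, IsSemialgebraicFunOn ℚ σ (p j)) → (∀ j, IsSemialgebraicFunOn ℚ σ (u j)) →
      (∀ j, ∀ x ∈ σ, 0 ≤ u j x) →
      (∀ j, (A j).domain = {z | (Fin.init z : Fin 1 → ℝ) ∈ σ ∧ 0 ≤ z (Fin.last 1) ∧ z (Fin.last 1) ≤ u j (Fin.init z)}) →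
      (∀ j, EqOn (A j).integrand (fun z => p j (Fin.init z) / (1 + z (Fin.last 1) ^ 2)) (A j).domain) →
      (∀ j, IntegrableOn (fun x => p j x * Real.arctan (u j x)) σ) →
      (∀ c, IsSemialgebraic ℚ (C c) ∧ IsOpen (C c) ∧ C c ⊆ σ) → Pairwise (Function.onFun Disjoint C) →
      volume (σ \ ⋃ c, C c) = 0 →
      (∀ c, ∃ (S : ℕ) (f' : Fin S → Fin l → ℤ) (m : Fin S → ℚ) (q' : Fin S → (Fin 1 → ℝ) → ℝ),
        (∀ s, IsSemialgebraicFunOn ℚ (C c) (q' s)) ∧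
        (∀ s, ∀ x ∈ C c, ∑ j, (f' s j : ℝ) * Real.arctan (u j x) = (m s : ℝ) * Real.pi) ∧
        (∀ x ∈ C c, ∑ s, q' s x * (m s : ℝ) = 0) ∧
        (∀ j, ∀ x ∈ C c, p j x = ∑ s, q' s x * (f' s j : ℝ))) →
      ∑ j, KZ.of (A j) ∈ KZ.relations := by
  intro l σ p u A N C hσ hp hu hu0 hAd hAi hint hC hdisj hnull hdata
  have hAd' : ∀ j, (A j).domain = KZlog.band σ (fun _ => 0) (u j) := fun j => by rw [hAd j]; rfl
  refine loc u hu A hAd' C (fun c => (hC c).1) (fun c => (hC c).2.2) hdisj hnull fun c AE hAEd hAEi => ?_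
  obtain ⟨S, f', m, q', -, hrel, hbud, hpq⟩ := hdata c
  exact cell_fold (hC c).1 (hC c).2.1 (fun j => (hp j).mono (hC c).2.2 (hC c).1)
    (fun j => (hu j).mono (hC c).2.2 (hC c).1) (fun j x hx => hu0 j x ((hC c).2.2 hx)) AE hAEd
    (fun j z hz => by
      rw [hAEi j]
      exact hAi j (by rw [hAd' j]; rw [hAEd j] at hz; exact ⟨(hC c).2.2 hz.1, hz.2⟩))
    (fun j => (hint j).mono_set (hC c).2.2) f' m q' hrel hbud hpq
end AngleFold

/-! ### §G THE BRIDGE: `AngleCellwiseFoldAt 1` (the tree's `…CircleLogP7.AngleCellwiseFoldAt`, = `CircleSplit.lean` §15 verbatim) PROVED.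
With `CircleSplit.lean` (g14) §25 `cylKernelZeroCirclePos_of_logFold_angleFold_wild` the circle node becomes
`CylKernelZeroCirclePos ⟸ LogCellwiseFoldAt 1 [tree: stub_cellwiseFold stub_coneDecomposition 1] ∧ CellCloseCSWild`:
`cylKernelZeroCirclePos_of_logFold_wild hL hW := cylKernelZeroCirclePos_of_logFold_angleFold_wild hL angleCellwiseFoldAt_one hW`. -/

/-- **`AngleCellwiseFoldAt 1` — PROVED** (angle addition in families at base dimension `1`; `AngleFold.angleCellwiseFold_one` by unfolding). -/
theorem angleCellwiseFoldAt_one : AngleCellwiseFoldAt 1 := AngleFold.angleCellwiseFold_one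

end Summit.KontsevichZagierPeriods.RootDecompRelativeModAbsolute.Rung30571.RegularisedLogLayer.CylLog.Leaf.G13

end
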